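import Literature.NumberTheory.EllipticCurves.NeronSigmaTateProofs
import Literature.NumberTheory.EllipticCurves.WeierstrassTorsion
import Mathlib.Analysis.Complex.RemovableSingularity
import Mathlib.Analysis.Complex.Liouville
import Mathlib.Topology.Algebra.Module.Cardinality
import HarnessLib

/-!
# The `q`-product expansion of `σ` (ATAEC Thm. I.6.4), proved; the archimedean local height theory closed

Topic `NumberTheory/EllipticCurves` (family `abc`, G06). Pure proofs (theorems only). This file
**discharges** the named fact
`Literature.NumberTheory.EllipticCurves.weierstrassSigma_ofUpperHalfPlane_eq_qProduct`
(`NeronSigmaFunction.lean`; Silverman, *Advanced Topics*, Thm. I.6.4: the `q`-product of the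
Weierstrass `σ`-function of `ℤτ + ℤ`) by Liouville's theorem, and with it the whole archimedean side
of the decomposition of `szpiro_imp_langHeightLowerBoundConjecture` (Hindry–Silverman 1988,
Thm. 0.3):

* `weierstrassSigma_ofUpperHalfPlane_eq_qProduct_holds` — ATAEC Thm. I.6.4;
* `neronLocalHeight_eq_neronFunction_holds` — the named fact of `LangHeightArchEstimate.lean`
  (**ATAEC Thm. VI.3.4(b)**: Tate's series on `E(ℂ) ≅ ℂ/(ℤτ + ℤ)` is the `q`-expansion
  `neronFunction τ`), now a theorem (`neronLocalHeight_eq_neronFunction_of_qProduct`,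
  `NeronSigmaTateProofs.lean`);
* `Petsche2006_exists_subset_le_neronLocalHeight_real_holds` — the named fact of
  `LangHeightSmallPoints.lean` (the archimedean step of Petsche's Prop. 7), now a theorem;
* the frontier of the formal proof of Szpiro ⇒ Lang over `ℚ` is now purely non-archimedean:
  `szpiro_imp_langHeightLowerBoundConjecture_of_lemma3_kodairaNeron` — Petsche's Lemma 3 (Tate's
  `p`-adic uniformisation) and the Kodaira–Néron facts of `KodairaNeron.lean`.

## Proof of I.6.4 (Whittaker–Watson §21.43)

With `q = e^{2πiτ}`, `u = e^{2πiz}`, let `F(z)` be the right-hand side. The products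
`∏ (1 − qⁿ⁺¹e^{±2πiz})` converge locally uniformly (`Summable.hasProdUniformlyOn_one_add`), so `F` is
entire; `F(z + 1) = −e^{η₂(z + ½)}F(z)` and, by the index shifts
`(1 − qu)∏(1 − qⁿ⁺²u) = ∏(1 − qⁿ⁺¹u)`, `(1 − u⁻¹)∏(1 − qⁿ⁺¹u⁻¹) = ∏(1 − qⁿu⁻¹)` and Legendre's
relation `η₂τ − η₁ = 2πi`, `F(z + τ) = −e^{η₁(z + τ/2)}F(z)` — the multipliers of `σ`
(`weierstrassSigma_add_ω₁/ω₂_holds`). Hence `F/σ` is periodic off the lattice; near `0`,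
`F/σ = (−1/2πi)·e^{…}·a(z)·R(z)/φ(z)` with `σ = zφ`, `1 − u = z a(z)` (`dslope`), analytic with
value `1` at `0`; its periodic extension is entire and bounded, hence `≡ 1` (Liouville), so `σ = F`
off the lattice and everywhere by continuity.

## References

* J. H. Silverman, *Advanced Topics in the Arithmetic of Elliptic Curves* (1994), Thm. I.6.4
  (pp. 53–54), Thm. VI.3.4.
* E. T. Whittaker, G. N. Watson, *A Course of Modern Analysis*, 4th ed., §21.43 ("the connexion
  between the sigma-function and the theta-functions"), §20.421.
-/

noncomputable section

open scoped UpperHalfPlane Real Topology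

open Complex Filter

namespace Literature.NumberTheory.EllipticCurves

open _root_.PeriodPair Literature.NumberTheory.EllipticCurves.ModularForms

/-! ### Products `∏ (1 − qⁿ⁺¹ c)`: convergence, shifts -/

section Products

variable {q : ℂ} (hq : ‖q‖ < 1)
include hq

/-- `∏_{n≥1} (1 − qⁿc)` converges for `|q| < 1` (as `∏ (1 + gₙ)` with `Σ|gₙ| < ∞`). [folklore] -/
theorem multipliable_one_sub_pow_succ_mul (c : ℂ) : Multipliable fun n : ℕ => 1 - q ^ (n + 1) * c := by
  have hs : Summable fun n : ℕ => -(q ^ (n + 1) * c) :=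
    (((summable_nat_add_iff (f := fun n : ℕ => q ^ n) 1).mpr
      (summable_geometric_of_norm_lt_one hq)).mul_right c).neg
  simpa [sub_eq_add_neg] using Complex.multipliable_one_add_of_summable hs

/-- `∏_{n≥0} (1 − qⁿc)` converges for `|q| < 1`. [folklore] -/
theorem multipliable_one_sub_pow_mul (c : ℂ) : Multipliable fun n : ℕ => 1 - q ^ n * c := by
  have hs : Summable fun n : ℕ => -(q ^ n * c) :=
    ((summable_geometric_of_norm_lt_one hq).mul_right c).neg
  simpa [sub_eq_add_neg] using Complex.multipliable_one_add_of_summable hs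

/-- Index shift: `(1 − qc) ∏_{n≥0} (1 − qⁿ⁺²c) = ∏_{n≥0} (1 − qⁿ⁺¹c)` (Mathlib `tprod_eq_zero_mul'`). [folklore] -/
theorem one_sub_mul_tprod_shift (c : ℂ) :
    (1 - q * c) * ∏' n : ℕ, (1 - q ^ (n + 2) * c) = ∏' n : ℕ, (1 - q ^ (n + 1) * c) := by
  have h := tprod_eq_zero_mul' (f := fun n : ℕ => 1 - q ^ (n + 1) * c)
    (by simpa [pow_succ, mul_assoc] using multipliable_one_sub_pow_succ_mul hq (q * c))
  rw [h]
  simp only [zero_add, pow_one]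

/-- Index shift: `(1 − c) ∏_{n≥0} (1 − qⁿ⁺¹c) = ∏_{n≥0} (1 − qⁿc)`. [folklore] -/
theorem one_sub_mul_tprod_shift₀ (c : ℂ) :
    (1 - c) * ∏' n : ℕ, (1 - q ^ (n + 1) * c) = ∏' n : ℕ, (1 - q ^ n * c) := by
  have h := tprod_eq_zero_mul' (f := fun n : ℕ => 1 - q ^ n * c) (multipliable_one_sub_pow_succ_mul hq c)
  rw [h]
  simp

/-- **The `q`-shift of the two-sided product** (the mechanism of `z ↦ z + τ`, i.e. `u ↦ qu`, in
Whittaker–Watson §21.43 / ATAEC I.6.4):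
`(1 − qu) ∏ (1 − qⁿ⁺²u)(1 − qⁿu⁻¹) = (1 − u⁻¹) ∏ (1 − qⁿ⁺¹u)(1 − qⁿ⁺¹u⁻¹)`. [folklore] -/
theorem qShift_tprod (u : ℂ) :
    (1 - q * u) * ∏' n : ℕ, (1 - q ^ (n + 2) * u) * (1 - q ^ n * u⁻¹) =
      (1 - u⁻¹) * ∏' n : ℕ, (1 - q ^ (n + 1) * u) * (1 - q ^ (n + 1) * u⁻¹) := by
  rw [Multipliable.tprod_mul (by simpa [pow_succ, mul_assoc] using multipliable_one_sub_pow_succ_mul hq (q * u))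
      (multipliable_one_sub_pow_mul hq u⁻¹),
    Multipliable.tprod_mul (multipliable_one_sub_pow_succ_mul hq u) (multipliable_one_sub_pow_succ_mul hq u⁻¹),
    ← one_sub_mul_tprod_shift hq u, ← one_sub_mul_tprod_shift₀ hq u⁻¹]
  ring

/-- The constant factors `((1 − qⁿ⁺¹)²)⁻¹ = 1 + qⁿ⁺¹(2 − qⁿ⁺¹)/(1 − qⁿ⁺¹)²` are multipliable. [folklore] -/
theorem multipliable_inv_one_sub_pow_sq : Multipliable fun n : ℕ => ((1 - q ^ (n + 1)) ^ 2)⁻¹ := by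
  -- `((1 − x)²)⁻¹ = 1 + x(2 − x)/(1 − x)²`
  have hq0 : 0 ≤ ‖q‖ := norm_nonneg _
  have hden : ∀ n : ℕ, 1 - ‖q‖ ≤ ‖1 - q ^ (n + 1)‖ := by
    intro n
    have h1 := norm_sub_norm_le (1 : ℂ) (q ^ (n + 1))
    rw [norm_one, norm_pow] at h1
    have h2 : ‖q‖ ^ (n + 1) ≤ ‖q‖ := pow_le_of_le_one hq0 hq.le (Nat.succ_ne_zero n)
    linarith
  have hpos : 0 < 1 - ‖q‖ := by linarith
  set g : ℕ → ℂ := fun n => q ^ (n + 1) * (2 - q ^ (n + 1)) / (1 - q ^ (n + 1)) ^ 2 with hg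
  have hfg : ∀ n : ℕ, ((1 - q ^ (n + 1)) ^ 2)⁻¹ = 1 + g n := by
    intro n
    have hne := one_sub_pow_succ_ne_zero hq n
    rw [hg]
    field_simp
    ring
  simp_rw [hfg]
  apply Complex.multipliable_one_add_of_summable
  refine Summable.of_norm_bounded (g := fun n : ℕ => 3 / (1 - ‖q‖) ^ 2 * ‖q‖ ^ (n + 1))
    (((summable_nat_add_iff (f := fun n : ℕ => ‖q‖ ^ n) 1).mpr
      (summable_geometric_of_lt_one hq0 hq)).mul_left _) fun n => ?_
  rw [hg]
  simp only [norm_div, norm_mul, norm_pow]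
  rw [div_le_iff₀ (pow_pos (lt_of_lt_of_le hpos (hden n)) 2)]
  have h2 : ‖2 - q ^ (n + 1)‖ ≤ 3 := by
    calc ‖2 - q ^ (n + 1)‖ ≤ ‖(2 : ℂ)‖ + ‖q ^ (n + 1)‖ := norm_sub_le _ _
      _ ≤ 2 + 1 := by
          rw [norm_pow]
          gcongr
          · norm_num
          · exact pow_le_one₀ hq0 hq.le
      _ = 3 := by norm_num
  have hd2 : (1 - ‖q‖) ^ 2 ≤ ‖1 - q ^ (n + 1)‖ ^ 2 := pow_le_pow_left₀ hpos.le (hden n) 2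
  calc ‖q‖ ^ (n + 1) * ‖2 - q ^ (n + 1)‖ ≤ ‖q‖ ^ (n + 1) * 3 := by gcongr
    _ = 3 / (1 - ‖q‖) ^ 2 * ‖q‖ ^ (n + 1) * (1 - ‖q‖) ^ 2 := by field_simp
    _ ≤ 3 / (1 - ‖q‖) ^ 2 * ‖q‖ ^ (n + 1) * ‖1 - q ^ (n + 1)‖ ^ 2 := by
        apply mul_le_mul_of_nonneg_left hd2
        positivity

/-- Splitting the quotient product of ATAEC I.6.4 into numerators and denominators:
`∏ (1 − qⁿu)(1 − qⁿu⁻¹)/(1 − qⁿ)² = (∏ (1 − qⁿu)(1 − qⁿu⁻¹)) · ∏ (1 − qⁿ)⁻²` (all three converge).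
[folklore] -/
theorem tprod_quot_eq (u : ℂ) :
    ∏' n : ℕ, (1 - q ^ (n + 1) * u) * (1 - q ^ (n + 1) * u⁻¹) / (1 - q ^ (n + 1)) ^ 2 =
      (∏' n : ℕ, (1 - q ^ (n + 1) * u) * (1 - q ^ (n + 1) * u⁻¹)) *
        ∏' n : ℕ, ((1 - q ^ (n + 1)) ^ 2)⁻¹ := by
  have hab : Multipliable fun n : ℕ => (1 - q ^ (n + 1) * u) * (1 - q ^ (n + 1) * u⁻¹) :=
    ((multipliable_one_sub_pow_succ_mul hq u).hasProd.mul (multipliable_one_sub_pow_succ_mul hq u⁻¹).hasProd).multipliable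
  rw [← Multipliable.tprod_mul hab (multipliable_inv_one_sub_pow_sq hq)]
  simp_rw [div_eq_mul_inv]

end Products

/-! ### Entire functions `z ↦ ∏ (1 − qⁿ⁺¹ e^{sz})` -/

section Entire

variable {q : ℂ} (hq : ‖q‖ < 1)
include hq

omit hq in
/-- On the closed disc `‖z‖ ≤ r`: `‖qⁿ⁺¹ e^{sz}‖ ≤ e^{‖s‖ r} ‖q‖ⁿ⁺¹`. [folklore] -/
theorem norm_pow_mul_cexp_le (s : ℂ) {r : ℝ} {z : ℂ} (hz : ‖z‖ ≤ r) (n : ℕ) :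
    ‖-(q ^ (n + 1) * cexp (s * z))‖ ≤ Real.exp (‖s‖ * r) * ‖q‖ ^ (n + 1) := by
  rw [norm_neg, norm_mul, norm_pow, norm_exp, mul_comm]
  gcongr
  calc (s * z).re ≤ ‖s * z‖ := Complex.re_le_norm _
    _ = ‖s‖ * ‖z‖ := norm_mul _ _
    _ ≤ ‖s‖ * r := by gcongr

/-- The product `∏ (1 − qⁿ⁺¹e^{sz})` converges uniformly on compact sets (Weierstrass `M`-test for
products, Mathlib `Summable.hasProdUniformlyOn_one_add`). [folklore] -/
theorem hasProdUniformlyOn_one_sub_pow_mul_cexp (s : ℂ) {K : Set ℂ} (hK : IsCompact K) :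
    HasProdUniformlyOn (fun (n : ℕ) (z : ℂ) => 1 - q ^ (n + 1) * cexp (s * z))
      (fun z => ∏' n : ℕ, (1 - q ^ (n + 1) * cexp (s * z))) K := by
  obtain ⟨r, hKr⟩ := hK.isBounded.subset_closedBall 0
  have hq0 : 0 ≤ ‖q‖ := norm_nonneg _
  have := Summable.hasProdUniformlyOn_one_add
    (f := fun (n : ℕ) (z : ℂ) => -(q ^ (n + 1) * cexp (s * z))) hK
    ((((summable_nat_add_iff (f := fun n : ℕ => ‖q‖ ^ n) 1).mpr
      (summable_geometric_of_lt_one hq0 hq)).mul_left (Real.exp (‖s‖ * r))))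
    (Eventually.of_forall fun n z hz => norm_pow_mul_cexp_le s (by simpa using hKr hz) n)
    (fun n => by fun_prop)
  simpa [sub_eq_add_neg] using this

/-- **`z ↦ ∏ (1 − qⁿ⁺¹e^{sz})` is entire** (a locally uniform limit of entire partial products;
Whittaker–Watson §21.1 for the theta products). [folklore] -/
theorem differentiable_tprod_one_sub_pow_mul_cexp (s : ℂ) :
    Differentiable ℂ fun z : ℂ => ∏' n : ℕ, (1 - q ^ (n + 1) * cexp (s * z)) := by
  have h : HasProdLocallyUniformly (fun (n : ℕ) (z : ℂ) => 1 - q ^ (n + 1) * cexp (s * z))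
      (fun z => ∏' n : ℕ, (1 - q ^ (n + 1) * cexp (s * z))) :=
    hasProdLocallyUniformly_of_forall_compact fun _ hK => hasProdUniformlyOn_one_sub_pow_mul_cexp hq s hK
  rw [HasProdLocallyUniformly, ← tendstoLocallyUniformlyOn_univ] at h
  exact differentiableOn_univ.mp
    (h.differentiableOn (.of_forall fun t => .fun_finsetProd fun n _ => by fun_prop) isOpen_univ)

end Entire


/-! ### The `q`-product is `σ` (ATAEC Thm. I.6.4) -/

/-- `e^{2πi(z + τ)} = q e^{2πiz}`, `q = e^{2πiτ}`. [folklore] -/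
theorem cexp_two_pi_I_mul_add_tau (τ z : ℂ) :
    cexp (2 * π * I * (z + τ)) = cexp (2 * π * I * τ) * cexp (2 * π * I * z) := by
  rw [mul_add, Complex.exp_add, mul_comm]

/-- The derivative of `w ↦ 1 − e^{2πiw}` at `0` is `−2πi`. [folklore] -/
theorem hasDerivAt_one_sub_cexp_zero :
    HasDerivAt (fun w : ℂ => 1 - cexp (2 * π * I * w)) (-(2 * π * I)) 0 := by
  have h1 : HasDerivAt (fun w : ℂ => 2 * π * I * w) (2 * π * I) 0 := by
    simpa using (hasDerivAt_id (0 : ℂ)).const_mul (2 * π * I)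
  have h2 := h1.cexp
  simp only [mul_zero, Complex.exp_zero, one_mul] at h2
  simpa using h2.const_sub 1

/-- **Silverman, *Advanced Topics*, Thm. I.6.4 — proved**: the `q`-product expansion
`σ(z; τ) = −(2πi)⁻¹ e^{½η(1)z²} e^{−πiz} (1 − u) ∏_{n≥1} (1 − qⁿu)(1 − qⁿu⁻¹)/(1 − qⁿ)²` of the
Weierstrass `σ`-function of `ℤτ + ℤ` (discharge of the named fact
`weierstrassSigma_ofUpperHalfPlane_eq_qProduct` of `NeronSigmaFunction.lean`). Proof
(Whittaker–Watson §21.43 rather than Silverman's integration of the `q`-series of `ζ`): the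
right-hand side `F` is entire (`differentiable_tprod_one_sub_pow_mul_cexp`) and has the same
multipliers as `σ` under `z ↦ z + 1` (`−e^{η₂(z + ½)}`, from `e^{−πi} = −1`) and `z ↦ z + τ`
(`−e^{η₁(z + τ/2)}`, from the `q`-shift of the product, `qShift`, and Legendre's relation
`η(1)τ − η(τ) = 2πi`, the tree's `PeriodPair.legendre_relation_of_neg`), so `F/σ` is `Λ_τ`-periodic
off `Λ_τ`; at `0` it extends analytically (`σ(z) = z·φ(z)` with `φ(0) = 1`, `1 − u = z·a(z)` with
`a = dslope`, `a(0) = −2πi`) with value `(−1/2πi)(−2πi) = 1`; translating, the extension `H` is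
entire and `Λ_τ`-periodic, hence bounded and constant (Liouville,
`Differentiable.apply_eq_apply_of_bounded` with `IsZLattice.isCompact_range_of_periodic`), `H ≡ 1`;
so `σ = F` off the lattice and, both being continuous, everywhere.
[cite: Silverman1994, Thm I.6.4] -/
theorem weierstrassSigma_ofUpperHalfPlane_eq_qProduct_holds :
    weierstrassSigma_ofUpperHalfPlane_eq_qProduct := by
  intro τ
  -- notation
  set L := ofUpperHalfPlane τ with hL
  set q : ℂ := cexp (2 * π * I * τ) with hq
  have hq1 : ‖q‖ < 1 := UpperHalfPlane.norm_exp_two_pi_I_lt_one τ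
  have hq0 : q ≠ 0 := exp_ne_zero _
  set C : ℂ := -(1 / (2 * π * I)) with hC
  set E₁ : ℂ → ℂ := fun z => cexp (1 / 2 * L.η₂ * z ^ 2) with hE₁
  set E₂ : ℂ → ℂ := fun z => cexp (-(π * I * z)) with hE₂
  set A : ℂ → ℂ := fun z => 1 - cexp (2 * π * I * z) with hA
  set R : ℂ → ℂ := fun z => ∏' n : ℕ, (1 - q ^ (n + 1) * cexp (2 * π * I * z)) *
    (1 - q ^ (n + 1) * (cexp (2 * π * I * z))⁻¹) / (1 - q ^ (n + 1)) ^ 2 with hR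
  set F : ℂ → ℂ := fun z => C * E₁ z * E₂ z * A z * R z with hF
  -- the statement is `σ = F`
  suffices hmain : L.weierstrassSigma = F by
    intro z
    have := congrFun hmain z
    simpa [hF, hC, hE₁, hE₂, hA, hR] using this
  -- the split form of `R`
  set A₁ : ℂ → ℂ := fun z => ∏' n : ℕ, (1 - q ^ (n + 1) * cexp (2 * π * I * z)) with hA₁
  set B₁ : ℂ → ℂ := fun z => ∏' n : ℕ, (1 - q ^ (n + 1) * (cexp (2 * π * I * z))⁻¹) with hB₁
  set Cst : ℂ := ∏' n : ℕ, ((1 - q ^ (n + 1)) ^ 2)⁻¹ with hCst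
  have hRsplit : ∀ z, R z = A₁ z * B₁ z * Cst := by
    intro z
    simp only [hR, hA₁, hB₁, hCst]
    rw [tprod_quot_eq hq1, Multipliable.tprod_mul (multipliable_one_sub_pow_succ_mul hq1 _)
      (multipliable_one_sub_pow_succ_mul hq1 _)]
  have hB₁' : B₁ = fun z => ∏' n : ℕ, (1 - q ^ (n + 1) * cexp (-(2 * π * I) * z)) := by
    funext z
    simp only [hB₁, neg_mul, Complex.exp_neg]
  -- `F` is entire
  have hA₁d : Differentiable ℂ A₁ := differentiable_tprod_one_sub_pow_mul_cexp hq1 (2 * π * I)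
  have hB₁d : Differentiable ℂ B₁ := hB₁' ▸ differentiable_tprod_one_sub_pow_mul_cexp hq1 (-(2 * π * I))
  have hRd : Differentiable ℂ R := by
    have : R = fun z => A₁ z * B₁ z * Cst := funext hRsplit
    rw [this]
    exact (hA₁d.mul hB₁d).mul_const Cst
  have hE₁d : Differentiable ℂ E₁ := by simp only [hE₁]; fun_prop
  have hE₂d : Differentiable ℂ E₂ := by simp only [hE₂]; fun_prop
  have hAd : Differentiable ℂ A := by simp only [hA]; fun_prop
  have hFd : Differentiable ℂ F := by
    simp only [hF]
    exact (((differentiable_const C).mul hE₁d).mul hE₂d).mul hAd |>.mul hRd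
  have hσd : Differentiable ℂ L.weierstrassSigma := L.differentiable_weierstrassSigma_holds
  -- the functional equations of `F`
  have hFE1 : ∀ z, F (z + 1) = -cexp (L.η₂ * (z + 1 / 2)) * F z := by
    intro z
    have hu : cexp (2 * π * I * (z + 1)) = cexp (2 * π * I * z) := cexp_two_pi_I_mul_add_one z
    have h1 : E₁ (z + 1) = E₁ z * cexp (L.η₂ * (z + 1 / 2)) := by
      simp only [hE₁, ← Complex.exp_add]
      congr 1
      ring
    have h2 : E₂ (z + 1) = -E₂ z := by
      simp only [hE₂]
      rw [show -(π * I * (z + 1)) = -(π * I * z) + (-π * I) by ring, Complex.exp_add]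
      have : cexp (-π * I) = -1 := by
        rw [show -(π : ℂ) * I = -(π * I) by ring, Complex.exp_neg, Complex.exp_pi_mul_I]
        norm_num
      rw [this]
      ring
    have h3 : A (z + 1) = A z := by simp only [hA, hu]
    have h4 : R (z + 1) = R z := by simp only [hR, hu]
    simp only [hF]
    rw [h1, h2, h3, h4]
    ring
  have hleg : L.η₂ * (τ : ℂ) - L.η₁ = 2 * π * I := by
    have h := L.legendre_relation_of_neg (by simp [hL, UpperHalfPlane.im_pos])
    simpa [hL] using h
  have hFEτ : ∀ z, F (z + τ) = -cexp (L.η₁ * (z + τ / 2)) * F z := by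
    intro z
    set u := cexp (2 * π * I * z) with hu
    have hu0 : u ≠ 0 := exp_ne_zero _
    have huτ : cexp (2 * π * I * (z + τ)) = q * u := cexp_two_pi_I_mul_add_tau τ z
    have hA₁τ : A₁ (z + τ) = ∏' n : ℕ, (1 - q ^ (n + 2) * u) := by
      simp only [hA₁, huτ]
      refine tprod_congr fun n => ?_
      ring
    have hB₁τ : B₁ (z + τ) = ∏' n : ℕ, (1 - q ^ n * u⁻¹) := by
      simp only [hB₁, huτ, mul_inv]
      refine tprod_congr fun n => ?_
      rw [pow_succ]
      field_simp
    have hprod : (1 - q * u) * A₁ (z + τ) * B₁ (z + τ) = (1 - u⁻¹) * A₁ z * B₁ z := by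
      rw [hA₁τ, hB₁τ]
      simp only [hA₁, hB₁, ← hu]
      rw [← one_sub_mul_tprod_shift hq1 u, ← one_sub_mul_tprod_shift₀ hq1 u⁻¹]
      ring
    have hAτ : A (z + τ) = 1 - q * u := by simp only [hA, huτ]
    have hE : E₁ (z + τ) * E₂ (z + τ) * (1 - u⁻¹) = -cexp (L.η₁ * (z + τ / 2)) * (E₁ z * E₂ z * (1 - u)) := by
      have hinv : (1 - u⁻¹) = -u⁻¹ * (1 - u) := by field_simp; ring
      have huinv : u⁻¹ = cexp (-(2 * π * I * z)) := by rw [hu, Complex.exp_neg]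
      rw [hinv, huinv]
      simp only [hE₁, hE₂]
      rw [show -cexp (L.η₁ * (z + τ / 2)) * (cexp (1 / 2 * L.η₂ * z ^ 2) * cexp (-(π * I * z)) * (1 - u)) =
        -(cexp (L.η₁ * (z + τ / 2)) * cexp (1 / 2 * L.η₂ * z ^ 2) * cexp (-(π * I * z))) * (1 - u) by ring,
        show cexp (1 / 2 * L.η₂ * (z + ↑τ) ^ 2) * cexp (-(π * I * (z + ↑τ))) * (-cexp (-(2 * π * I * z)) * (1 - u)) =
        -(cexp (1 / 2 * L.η₂ * (z + ↑τ) ^ 2) * cexp (-(π * I * (z + ↑τ))) * cexp (-(2 * π * I * z))) * (1 - u) by ring]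
      congr 2
      rw [← Complex.exp_add, ← Complex.exp_add, ← Complex.exp_add, ← Complex.exp_add]
      congr 1
      linear_combination (z + (τ : ℂ) / 2) * hleg
    calc F (z + τ) = C * (E₁ (z + τ) * E₂ (z + τ)) * (A (z + τ) * A₁ (z + τ) * B₁ (z + τ)) * Cst := by
          simp only [hF, hRsplit]; ring
      _ = C * (E₁ (z + τ) * E₂ (z + τ)) * ((1 - u⁻¹) * A₁ z * B₁ z) * Cst := by rw [hAτ, hprod]
      _ = C * (E₁ (z + τ) * E₂ (z + τ) * (1 - u⁻¹)) * (A₁ z * B₁ z) * Cst := by ring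
      _ = C * (-cexp (L.η₁ * (z + τ / 2)) * (E₁ z * E₂ z * (1 - u))) * (A₁ z * B₁ z) * Cst := by rw [hE]
      _ = -cexp (L.η₁ * (z + τ / 2)) * F z := by
          simp only [hF, hRsplit, hA, ← hu]; ring
  -- `Φ = F/σ` is periodic off the lattice
  have hω₁ : L.ω₁ = τ := rfl
  have hω₂ : L.ω₂ = 1 := rfl
  have hΦ1 : ∀ z, z ∉ L.lattice → F (z + 1) / L.weierstrassSigma (z + 1) = F z / L.weierstrassSigma z := by
    intro z hz
    have hs := L.weierstrassSigma_add_ω₂_holds z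
    rw [hω₂] at hs
    rw [hs, hFE1, show (1 : ℂ) / 2 = 1 / 2 from rfl]
    have hne : -cexp (L.η₂ * (z + 1 / 2)) ≠ 0 := neg_ne_zero.mpr (exp_ne_zero _)
    rw [mul_div_mul_left _ _ hne]
  have hΦτ : ∀ z, z ∉ L.lattice → F (z + τ) / L.weierstrassSigma (z + τ) = F z / L.weierstrassSigma z := by
    intro z hz
    have hs := L.weierstrassSigma_add_ω₁_holds z
    rw [hω₁] at hs
    rw [hs, hFEτ]
    have hne : -cexp (L.η₁ * (z + τ / 2)) ≠ 0 := neg_ne_zero.mpr (exp_ne_zero _)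
    rw [mul_div_mul_left _ _ hne]
  -- the regularisation at `0`: `F z / σ z = Ψ z` near `0`
  set φ : ℂ → ℂ := fun w => ∏' l : L.lattice, sigmaFactor w l with hφ
  have hσφ : ∀ w, L.weierstrassSigma w = w * φ w := fun w => rfl
  have hφ0 : φ 0 = 1 := L.tprod_sigmaFactor_zero
  have hφd : Differentiable ℂ φ := L.differentiable_tprod_sigmaFactor
  set a : ℂ → ℂ := dslope A 0 with ha
  have hA0 : A 0 = 0 := by simp [hA]
  have had : Differentiable ℂ a := by
    have := (Complex.differentiableOn_dslope (univ_mem (f := 𝓝 (0 : ℂ)))).mpr hAd.differentiableOn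
    exact differentiableOn_univ.mp this
  have haz : ∀ z, z ≠ 0 → A z = z * a z := by
    intro z hz
    simp only [ha, dslope_of_ne _ hz, slope_def_field, hA0, sub_zero]
    field_simp
  have ha0 : a 0 = -(2 * π * I) := by
    simp only [ha, dslope_same]
    exact hasDerivAt_one_sub_cexp_zero.deriv
  set Ψ : ℂ → ℂ := fun z => C * E₁ z * E₂ z * a z * R z / φ z with hΨ
  have hΨan : AnalyticAt ℂ Ψ 0 := by
    simp only [hΨ]
    exact (((((analyticAt_const).mul (hE₁d.analyticAt 0)).mul (hE₂d.analyticAt 0)).mul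
      (had.analyticAt 0)).mul (hRd.analyticAt 0)).div (hφd.analyticAt 0) (by simp [hφ0])
  have hΦΨ : ∀ z, z ∉ L.lattice → F z / L.weierstrassSigma z = Ψ z := by
    intro z hz
    have hz0 : z ≠ 0 := fun h => hz (h ▸ zero_mem _)
    have hφz : φ z ≠ 0 := L.tprod_sigmaFactor_ne_zero hz
    simp only [hF, hΨ, hσφ z, haz z hz0]
    field_simp
  -- the value `Ψ 0 = 1`
  have hR0 : R 0 = 1 := by
    have h1 : ∀ n : ℕ, (1 - q ^ (n + 1) * cexp (2 * π * I * 0)) *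
        (1 - q ^ (n + 1) * (cexp (2 * π * I * 0))⁻¹) / (1 - q ^ (n + 1)) ^ 2 = 1 := by
      intro n
      have hne := one_sub_pow_succ_ne_zero hq1 n
      rw [mul_zero, Complex.exp_zero, inv_one, mul_one, ← pow_two, div_self (pow_ne_zero 2 hne)]
    simp only [hR]
    rw [tprod_congr h1, tprod_one]
  have hΨ0 : Ψ 0 = 1 := by
    simp only [hΨ, hφ0, ha0, hR0, hE₁, hE₂, hC, mul_zero, Complex.exp_zero, neg_zero,
      zero_pow two_ne_zero, div_one, mul_one]
    have h2πI : (2 * π * I : ℂ) ≠ 0 :=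
      mul_ne_zero (mul_ne_zero two_ne_zero (Complex.ofReal_ne_zero.mpr Real.pi_ne_zero)) I_ne_zero
    field_simp
  -- the entire function `H`
  classical
  set H : ℂ → ℂ := fun w => if w ∈ L.lattice then Ψ 0 else F w / L.weierstrassSigma w with hH
  have hHoff : ∀ w, w ∉ L.lattice → H w = F w / L.weierstrassSigma w := fun w hw => by simp [hH, hw]
  have hHan0 : AnalyticAt ℂ H 0 := by
    refine hΨan.congr ?_
    filter_upwards [L.compl_lattice_sdiff_singleton_mem_nhds 0] with w hw'
    by_cases hw0 : w = 0
    · subst hw0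
      simp [hH]
    · have hwΛ : w ∉ L.lattice := fun h' => hw' ⟨h', hw0⟩
      rw [hHoff w hwΛ, hΦΨ w hwΛ]
  -- periodicity of `H`
  have hmemω : ∀ {ω : ℂ}, ω ∈ L.lattice → ∀ w : ℂ, (w + ω ∈ L.lattice ↔ w ∈ L.lattice) :=
    fun hωΛ w => ⟨fun h' => by simpa using sub_mem h' hωΛ, fun h' => add_mem h' hωΛ⟩
  have hHω : ∀ {ω : ℂ}, ω ∈ L.lattice →
      (∀ z, z ∉ L.lattice → F (z + ω) / L.weierstrassSigma (z + ω) = F z / L.weierstrassSigma z) →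
      ∀ w, H (w + ω) = H w := by
    intro ω hωΛ hq w
    by_cases hw' : w ∈ L.lattice
    · simp [hH, hw', (hmemω hωΛ w).mpr hw']
    · rw [hHoff w hw', hHoff (w + ω) (fun h' => hw' ((hmemω hωΛ w).mp h'))]
      exact hq w hw'
  have hHsub : ∀ {ω : ℂ}, (∀ w, H (w + ω) = H w) → ∀ w, H (w - ω) = H w := by
    intro ω hω w
    have := hω (w - ω)
    rw [sub_add_cancel] at this
    exact this.symm
  have hHper : ∀ ℓ ∈ L.lattice, ∀ w, H (w + ℓ) = H w := by
    intro ℓ hℓ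
    induction hℓ using Submodule.span_induction with
    | mem x hx =>
      rcases hx with rfl | rfl
      · rw [hω₁]; exact hHω (hω₁ ▸ L.ω₁_mem_lattice) hΦτ
      · rw [hω₂]; exact hHω (hω₂ ▸ L.ω₂_mem_lattice) hΦ1
    | zero => simp
    | add x y _ _ hx hy => intro w; rw [← add_assoc, hy, hx]
    | smul n x _ hx =>
      intro w
      induction n using Int.induction_on generalizing w with
      | zero => simp
      | succ n ih => rw [add_smul, one_smul, ← add_assoc, hx, ih]
      | pred n ih => rw [sub_smul, one_smul, ← add_sub_assoc, hHsub hx, ih]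
  -- `H` is analytic everywhere
  have hHan : ∀ w, AnalyticAt ℂ H w := by
    intro w
    by_cases hw' : w ∈ L.lattice
    · have hcomp : H = fun z => H (z - w) := by
        funext z
        have := hHper w hw' (z - w)
        rwa [sub_add_cancel] at this
      rw [hcomp]
      have h0 : AnalyticAt ℂ H (w - w) := by rwa [sub_self]
      exact AnalyticAt.comp (g := H) (f := fun z => z - w) h0 (analyticAt_id.fun_sub analyticAt_const)
    · have han : AnalyticAt ℂ (fun z => F z / L.weierstrassSigma z) w :=
        (hFd.analyticAt w).div (hσd.analyticAt w) (L.weierstrassSigma_ne_zero hw')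
      refine han.congr ?_
      filter_upwards [L.isClosed_lattice.isOpen_compl.mem_nhds hw'] with z hz
      exact (hHoff z hz).symm
  have hHd : Differentiable ℂ H := fun w => (hHan w).differentiableAt
  -- Liouville: `H` is constant, `= H 0 = 1`
  have hconst : ∀ w, H w = 1 := by
    intro w
    have h := hHd.apply_eq_apply_of_bounded (IsZLattice.isCompact_range_of_periodic L.lattice H
      hHd.continuous (fun z ℓ hℓ => hHper ℓ hℓ z)).isBounded w 0
    rw [h]
    simp [hH, hΨ0]
  -- conclude off the lattice, then everywhere by continuity
  have hoff : ∀ z, z ∉ L.lattice → L.weierstrassSigma z = F z := by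
    intro z hz
    have h := hconst z
    rw [hHoff z hz, div_eq_one_iff_eq (L.weierstrassSigma_ne_zero hz)] at h
    exact h.symm
  have hdense : Dense ((L.lattice : Set ℂ)ᶜ) := by
    have hΛcount : (L.lattice : Set ℂ).Countable := by
      have : (L.lattice : Set ℂ) = Set.range fun p : ℤ × ℤ => (p.1 : ℂ) * L.ω₁ + (p.2 : ℂ) * L.ω₂ := by
        ext x
        simp only [SetLike.mem_coe, mem_lattice, Set.mem_range, Prod.exists]
      rw [this]
      exact Set.countable_range _
    exact hΛcount.dense_compl ℝ
  exact Continuous.ext_on hdense hσd.continuous hFd.continuous fun z hz => hoff z hz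


/-! ### Discharges and the new frontier -/

/-- **Discharge of `neronLocalHeight_eq_neronFunction`** (Silverman ATAEC Thm. VI.3.4(b): Tate's
series on `E(ℂ) ≅ ℂ/(ℤτ + ℤ)` is the Néron function `neronFunction τ`), from Thm. VI.3.2
(`NeronSigmaTateProofs.lean`), Thm. VI.3.4 (`NeronSigmaFunctionProofs.lean`) and Thm. I.6.4 above.
[cite: Silverman1994, Thm VI.3.4] -/
theorem neronLocalHeight_eq_neronFunction_holds : neronLocalHeight_eq_neronFunction :=
  neronLocalHeight_eq_neronFunction_of_qProduct weierstrassSigma_ofUpperHalfPlane_eq_qProduct_holds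

/-- **Discharge of `Petsche2006_exists_subset_le_neronLocalHeight_real`** (Petsche 2006, proof of
Prop. 7, the archimedean step over `ℚ`): all its inputs — complex uniformisation, ATAEC VI.3.4 and
Hindry–Silverman's Lemma 5 — are now theorems. [cite: Petsche2006, proof of Prop. 7] -/
theorem Petsche2006_exists_subset_le_neronLocalHeight_real_holds :
    Petsche2006_exists_subset_le_neronLocalHeight_real :=
  Petsche2006_exists_subset_le_neronLocalHeight_real_of_neronFunction neronLocalHeight_eq_neronFunction_holds

open IsDedekindDomain in
/-- **Szpiro ⇒ Lang's height lower bound over `ℚ`, conditional on the non-archimedean local height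
theory only** (`szpiro_imp_langHeightLowerBoundConjecture`; Hindry–Silverman 1988, Thm. 0.3):
Petsche's Lemma 3 (`h3`, Tate's `p`-adic uniformisation) and the Kodaira–Néron facts of
`KodairaNeron.lean` at the local minimal models (`h4`, `hsplit`). The archimedean theory (ATAEC
VI.1–VI.3, Hindry–Silverman's Lemma 5, the `q`-product of `σ`) is entirely proved in the tree.
[cite: HindrySilverman1988, Thm 0.3] -/
theorem szpiro_imp_langHeightLowerBoundConjecture_of_lemma3_kodairaNeron
    (h3 : Petsche2006_lemma3)
    (h4 : ∀ (W : WeierstrassCurve ℚ) (v : HeightOneSpectrum ℤ),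
      (W.localMinimalModel v).index_goodReductionSubgroup_le_four (v.adicCompletionIntegers ℚ))
    (hsplit : ∀ (W : WeierstrassCurve ℚ) (v : HeightOneSpectrum ℤ),
      (W.localMinimalModel v).index_goodReductionSubgroup_of_hasSplitMultiplicativeReduction
        (v.adicCompletionIntegers ℚ)) :
    szpiro_imp_langHeightLowerBoundConjecture :=
  szpiro_imp_langHeightLowerBoundConjecture_of_uniformisationFacts h3 h4 hsplit
    neronLocalHeight_eq_neronFunction_holds

open IsDedekindDomain in
/-- **Petsche 2006, Prop. 7 over `ℚ`, conditional on Lemma 3 and Kodaira–Néron only.**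
[cite: Petsche2006, Prop. 7] -/
theorem Petsche2006_card_smallPoints_le_of_lemma3_kodairaNeron
    (h3 : Petsche2006_lemma3)
    (h4 : ∀ (W : WeierstrassCurve ℚ) (v : HeightOneSpectrum ℤ),
      (W.localMinimalModel v).index_goodReductionSubgroup_le_four (v.adicCompletionIntegers ℚ))
    (hsplit : ∀ (W : WeierstrassCurve ℚ) (v : HeightOneSpectrum ℤ),
      (W.localMinimalModel v).index_goodReductionSubgroup_of_hasSplitMultiplicativeReduction
        (v.adicCompletionIntegers ℚ)) :
    Petsche2006_card_smallPoints_le :=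
  Petsche2006_card_smallPoints_le_of_uniformisationFacts h3 h4 hsplit neronLocalHeight_eq_neronFunction_holds

end Literature.NumberTheory.EllipticCurves

end
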